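import Mathlib.LinearAlgebra.Eigenspace.Triangularizable
import Mathlib.Algebra.Ring.GeomSum
import HarnessLib

/-!
# `IrreducibleOffSector`: an eigenvector of eigenvalue `≠ 1` of a finite-order endomorphism
(crux stmt-Langlands-14329 `IrreducibilityBySelfDuality.IrreducibleOffSector`, line `Sketch`;
`--supports` file, pure linear algebra; continuation lead c7, BC-ascent package, stub W1)

Helper for the BASE-CHANGE ASCENT closure operator of the crux "cuspidal ⇒ irreducible".  Its
Galois core is Clifford's dichotomy for a normal subgroup `N ◁ G` with finite cyclic quotient: an
irreducible `π` restricted to `N` stays irreducible unless `π ≅ π ⊗ χ` for a non-trivial character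
`χ` of `G/N`.  In that proof, conjugation by `π(g₀)` (`g₀N` a generator of `G/N`, of order dividing
`m`) is a linear operator `A` on the finite-dimensional algebra `End_N(π)` with `A ^ m = 1` and
`A ≠ 1`; the present file supplies an eigenvector `T` of `A` with eigenvalue `c ≠ 1` (and then
`c ^ m = 1`), over an algebraically closed field in which `m ≠ 0`.

* `exists_eigenvector_ne_one_of_pow_eq_one` — if `A ^ m = 1`, `A ≠ 1` and `(m : k) ≠ 0` over an
  algebraically closed field `k`, then `A` has an eigenvector with eigenvalue `c ≠ 1`, `c ^ m = 1`.

Proof: `U := range (A - 1)` is non-zero (`A ≠ 1`) and `A`-stable, so `A|_U` has an eigenvector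
`T = (A - 1) w ∈ U`, `A T = c • T`.  If `c = 1` then `(∑_{i<m} A ^ i) T = m • T`, while
`(∑_{i<m} A ^ i) (A - 1) = A ^ m - 1 = 0` (`geom_sum_mul`) gives `(∑_{i<m} A ^ i) T = 0`; as
`(m : k) ≠ 0` this forces `T = 0`, a contradiction.  Finally `T = (A ^ m) T = c ^ m • T` gives
`c ^ m = 1`.

References: folklore (Maschke-type averaging; e.g. J.-P. Serre, *Linear representations of finite
groups* (1977), §1.3).
-/

noncomputable section

-- `Summit.Langlands.Langlands.…` (summit = sub-problem name, D-0017 layout) trips `dupNamespace`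
set_option linter.dupNamespace false

namespace Summit.Langlands.Langlands.Theorems.IrreducibleOffSector

/-- **A finite-order non-identity endomorphism has an eigenvector of eigenvalue `≠ 1`.**  Let `k` be
an algebraically closed field, `F` a finite-dimensional `k`-vector space and `A : F →ₗ[k] F` with
`A ^ m = 1`, `A ≠ 1` and `(m : k) ≠ 0`.  Then there are `c : k` and `T : F`, `T ≠ 0`, with
`A T = c • T`, `c ≠ 1` and `c ^ m = 1`.  (The eigenvector is found in the `A`-stable non-zero
subspace `range (A - 1)`, on which `1` is not an eigenvalue by the averaging identity
`(∑_{i<m} A ^ i) (A - 1) = A ^ m - 1 = 0`.) [folklore] -/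
theorem exists_eigenvector_ne_one_of_pow_eq_one {k : Type*} [Field k] [IsAlgClosed k]
    {F : Type*} [AddCommGroup F] [Module k F] [FiniteDimensional k F]
    (A : F →ₗ[k] F) {m : ℕ} (hm : (m : k) ≠ 0) (hA : A ^ m = 1) (hA1 : A ≠ 1) :
    ∃ (c : k) (T : F), T ≠ 0 ∧ A T = c • T ∧ c ≠ 1 ∧ c ^ m = 1 := by
  -- the `A`-stable subspace `U := range (A - 1)`, non-zero since `A ≠ 1`
  set U : Submodule k F := LinearMap.range (A - 1) with hU_def
  have hU : ∀ x ∈ U, A x ∈ U := by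
    rintro _ ⟨w, rfl⟩
    refine ⟨A w, ?_⟩
    simp only [LinearMap.sub_apply, Module.End.one_apply, map_sub]
  have hUne : U ≠ ⊥ := by
    intro h
    rw [hU_def, LinearMap.range_eq_bot, sub_eq_zero] at h
    exact hA1 h
  haveI : Nontrivial U := Submodule.nontrivial_iff_ne_bot.mpr hUne
  -- an eigenvector `u` of `A|_U` (algebraically closed field, `U` finite-dimensional, `U ≠ 0`)
  obtain ⟨c, hc⟩ := Module.End.exists_eigenvalue (A.restrict hU)
  obtain ⟨u, hu⟩ := hc.exists_hasEigenvector
  have hu0 : (u : F) ≠ 0 := fun h =>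
    (Module.End.hasEigenvector_iff.mp hu).2 (Submodule.coe_eq_zero.mp h)
  have hAu : A (u : F) = c • (u : F) := by
    have h := congrArg Subtype.val hu.apply_eq_smul
    simpa using h
  have hT : Module.End.HasEigenvector A c (u : F) :=
    Module.End.hasEigenvector_iff.mpr ⟨Module.End.mem_eigenspace_iff.mpr hAu, hu0⟩
  refine ⟨c, u, hu0, hAu, ?_, ?_⟩
  · -- `c ≠ 1`: otherwise `m • u = (∑ A ^ i) u = (∑ A ^ i) (A - 1) w = (A ^ m - 1) w = 0`
    rintro rfl
    obtain ⟨w, hw⟩ : (u : F) ∈ U := u.2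
    have h0 : (∑ i ∈ Finset.range m, A ^ i) (u : F) = 0 := by
      rw [← hw, ← Module.End.mul_apply, geom_sum_mul, hA, sub_self, LinearMap.zero_apply]
    have h1 : (∑ i ∈ Finset.range m, A ^ i) (u : F) = (m : k) • (u : F) := by
      simp only [LinearMap.sum_apply, hT.pow_apply, one_pow, one_smul, Finset.sum_const,
        Finset.card_range, Nat.cast_smul_eq_nsmul]
    rw [h1] at h0
    rcases smul_eq_zero.mp h0 with h | h
    · exact hm h
    · exact hu0 h
  · -- `c ^ m = 1`: `u = (A ^ m) u = c ^ m • u` with `u ≠ 0`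
    have h := hT.pow_apply m
    rw [hA, Module.End.one_apply] at h
    have h' : (c ^ m - 1) • (u : F) = 0 := by rw [sub_smul, one_smul, ← h, sub_self]
    rcases smul_eq_zero.mp h' with h'' | h''
    · exact sub_eq_zero.mp h''
    · exact absurd h'' hu0

end Summit.Langlands.Langlands.Theorems.IrreducibleOffSector

end
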